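import Literature.Probability.Percolation.ArmSeparationNearCriticalFour
import Literature.Probability.Percolation.KestenScalingThetaFromTwoAltDisplays
import Literature.Probability.Percolation.AltFourArmLowerBound
import HarnessLib

/-!
# `θ(p) ≍ P_p(0 ↔ ∂Λ_{L(p)})`: discharge of `Nolin2008_cor41`

Topic `Literature/Probability/Percolation`; family `crit-perc` / near-critical percolation on `𝕋`.
The named fact `Nolin2008_cor41` of `NearCriticalScaling` (Nolin 2008, §7.4, Cor. 41
[arXiv 0711.4948: Cor. 39]: at distance `L(p)` one is not far from infinity,
`c · P_p(0 ↔ ∂Λ_{L_ε(p)}) ≤ θ(p)` for `p` in a right neighbourhood of `1/2`) is proved: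
`KestenScalingThetaFromTwoAltDisplays.Nolin2008_cor41_of_altSeparation_of_altLB` reduces it to two
displays on the alternating four-arm event below Werner's length — the arm-separation display
`(hsepA)`, which is `altSeparation_display` (`ArmSeparationNearCriticalFour`: Nolin's Thm. 11 for
`σ = BWBW`, §4.2–4.4, formalised in the `ArmSeparation*Four` files), and the a-priori lower bound
`(hLB)`, which is `altFourArm_lowerBound` (`AltFourArmLowerBound`). This file is a leaf (it is not
`NearCriticalScalingProofs`, which lies below the arm-separation files in the import order).
Everything here is proved; no named facts are introduced.

## References

* P. Nolin, Near-critical percolation in two dimensions, *Electron. J. Probab.* 13 (2008), §4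
  Thm. 11, §7.4 Cor. 41 (arXiv 0711.4948: Thm. 10, Cor. 39) [Nolin2008].
* H. Kesten, Scaling relations for 2D-percolation, *Comm. Math. Phys.* 109 (1987), Lemma 6, Thm. 2 [Kesten1987].
* W. Werner, Lectures on two-dimensional critical percolation, PCMI 2007 (2009), Lecture 6, §1, §5 [WernerPCMI2009].
-/

noncomputable section

namespace Literature.Probability.Percolation

/-- **Nolin 2008, Cor. 41 holds**: `θ(p) ≥ c · P_p(0 ↔ ∂Λ_{L_ε(p)})` for `p` in a right
neighbourhood of `1/2`, for every small `ε` — from the near-critical arm-separation theorem for four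
alternating arms (`altSeparation_display`) and the a-priori lower bound of the alternating four-arm
event (`altFourArm_lowerBound`), through `Nolin2008_cor41_of_altSeparation_of_altLB`. [cite: Nolin2008, §7.4 Cor. 41 with §4 Thm. 11 (arXiv 0711.4948: Cor. 39, Thm. 10)] -/
theorem Nolin2008_cor41_holds : Nolin2008_cor41 :=
  Nolin2008_cor41_of_altSeparation_of_altLB altSeparation_display altFourArm_lowerBound

end Literature.Probability.Percolation
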